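import Summits.QuantumFields.YangMills.Theorems.FemtoCurvatureSkewness.Negative.WeakCoupling
import Summits.QuantumFields.YangMills.Theorems.LangevinControlUVLatticeGapInUVUnitsRulerRigidity
import Summits.QuantumFields.YangMills.Theorems.LangevinControlUVFemtoCurvatureSkewnessAnalyticCoupling

/-!
# `FemtoCurvatureSkewnessC` — negative-side support II: the other load-bearing clauses of the conclusion, and the exact
# extent of its `∃ a` freedom (constants)

Support file for crux `stmt-QuantumFields-16205` (`LangevinControlUV.FemtoCurvatureSkewnessC`), standing disprover (cdisprove gen 1),
extracted from the work file `Cruxes/FemtoCurvatureSkewnessC/Disproof.lean` §§2–4 (companion of this seat's `ContinuityContent.lean`,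
p122377, which it does not import).  Theorems only, no `sorry`, nothing posited; inputs are the landed toolkit
`Theorems/FemtoCurvatureSkewness/Negative/*`, the landed ruler rigidity (`rulerRigidity_continuous`) and the landed analyticity of
`β ↦ κ₃(L, β, n)` (`kappa3_zero_set_dichotomy`).

* `not_exists_allCouplings` — the weak-coupling threshold `β₁` is load-bearing for EVERY output map (β = 0 is an exact zero of `κ₃`).
* `not_exists_uniform` — no output map carries a scale-invariant witness `c₃ ≤ n¹²|κ₃|`: `Γ₃ → 0⁺` is forced (asymptotic-freedom
  dividend of the three-point function, from fixed-torus concentration alone).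
* `global_of_noGuard`, `not_noGuard_of_infrared_zeros` — the femto GUARD `L·a β ≤ ℓ₁` of the conclusion is load-bearing exactly modulo
  the infrared sign question: without it the witness is GLOBAL non-vanishing of `κ₃` above `β₁` in all volumes, killed by exact zeros at
  arbitrarily large coupling in some volumes (forced on every torus with a strong→weak sign change, `exists_zero_of_sign_change`).
* `twoPointPackage_const_mul`, `skewnessPackage_const_mul`, `answer_const_mul` — the rebundling freedom REALISED: if `a` answers the
  crux at `(G, r)` so does `M·a`, `M ≥ 1` (deeper-femto windows, shapes relabelled `Γ(s/M)`);
  `continuous_package_maps_comparable` — and constants are ALL the freedom: two continuous package maps of one `(G, r)` are `≍`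
  eventually (ruler rigidity in the `TwoPointPackage` vocabulary).  Hence kill criterion II of `ContinuityContent` is exact.
* `frequently_zero_cases`, `not_cruxC_of_identically_zero_torus` — kill criterion I (`ContinuityContent`) refined by analyticity: "frequently zero as
  `β → ∞`" on a fixed torus means `κ₃(L, ·, n) ≡ 0` or isolated zeros accumulating at `+∞`; the identically-zero case alone (with a
  continuous package witness) already refutes the crux.
-/

set_option autoImplicit false

noncomputable section

namespace Summit.QuantumFields.YangMills.Theorems.FemtoCurvatureSkewnessC.Negative

open MeasureTheory Filter Topology
open Literature.MathematicalPhysics.QuantumFieldTheory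
open Summit.QuantumFields.YangMills.Theses.LangevinControlUV (FemtoCurvatureSkewnessC)
open Summit.QuantumFields.YangMills.Theorems.FemtoCurvatureSkewness.Negative
open Summit.QuantumFields.YangMills.Theorems.FemtoCurvatureSkewness (kappa3_zero_set_dichotomy)
open Summit.QuantumFields.YangMills.Theorems.LatticeGapInUVUnits.OneRuler (rulerRigidity_continuous)

section Clauses

variable {G : Type} [Group G] [TopologicalSpace G] [IsTopologicalGroup G] [CompactSpace G]
  [MeasurableSpace G] [BorelSpace G]

/-- **`β₁` is load-bearing**: no unit map at all carries the two-point package together with the ALL-COUPLINGS strengthening of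
the skewness witness — `β = 0` is an exact zero of `κ₃` on every torus (landed `not_skewnessBoundAllCouplings`). -/
theorem not_exists_allCouplings (r : LatticeRep G) :
    ¬ ∃ a : ℝ → ℝ, Continuous a ∧ TwoPointPackage r a ∧ SkewnessBoundAllCouplings r a := by
  rintro ⟨a, -, hP, hS⟩
  obtain ⟨Γ, β₀, ℓ₀, c, C, -, -, ha, -, -⟩ := id hP
  exact not_skewnessBoundAllCouplings r a ha hS

/-- **`Γ₃ → 0⁺` is forced**: no unit map carries the package together with a UNIFORM (scale-invariant) witness `c₃ ≤ n¹²|κ₃|` on its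
femto boxes (landed `not_uniformSkewness`: on a fixed torus `κ₃ → 0` as `β → ∞`). -/
theorem not_exists_uniform (r : LatticeRep G) :
    ¬ ∃ a : ℝ → ℝ, Continuous a ∧ TwoPointPackage r a ∧ UniformSkewness r a := by
  rintro ⟨a, -, hP, hS⟩
  obtain ⟨Γ, β₀, ℓ₀, c, C, -, -, ha, ha0, -⟩ := id hP
  exact not_uniformSkewness r ha ha0 hS

/-- **Without the femto guard the witness is GLOBAL non-vanishing.**  If the skewness clause held WITHOUT `L·a β ≤ ℓ₁` (and with
`Γ₃ > 0` on `(0, ∞)`, its argument being then unbounded), `κ₃(L, β, n) ≠ 0` for all `β ≥ β₁`, all `L ≥ 8n ≥ 8` — confinement-scale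
triangles included: the a-free infrared statement no ultraviolet line supplies. -/
theorem global_of_noGuard (r : LatticeRep G) {a : ℝ → ℝ} (ha : ∀ β, 0 < a β) {Γ₃ : ℝ → ℝ} {β₁ c₃ : ℝ} (hc₃ : 0 < c₃)
    (hΓ₃ : ∀ s : ℝ, 0 < s → 0 < Γ₃ s)
    (hb : ∀ (L : ℕ) [NeZero L] (β : ℝ), β₁ ≤ β →
      ∀ n : ℕ, 1 ≤ n → 8 * n ≤ L → c₃ * Γ₃ ((n : ℝ) * a β) ≤ (n : ℝ) ^ 12 * |kappa3 r L β n|) :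
    ∀ (L : ℕ) [NeZero L] (β : ℝ) (n : ℕ), β₁ ≤ β → 1 ≤ n → 8 * n ≤ L → kappa3 r L β n ≠ 0 := by
  intro L _ β n hβ hn h8 h0
  have key := hb L β hβ n hn h8
  rw [h0, abs_zero, mul_zero] at key
  have hn' : (0 : ℝ) < n := by exact_mod_cast hn
  exact absurd key (not_le.2 (mul_pos hc₃ (hΓ₃ _ (mul_pos hn' (ha β)))))

/-- **So the guard is load-bearing exactly modulo the infrared sign question**: exact zeros of `κ₃` at arbitrarily large coupling in
SOME volumes kill the guard-free witness for every positive unit map and all constants. -/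
theorem not_noGuard_of_infrared_zeros (r : LatticeRep G) {a : ℝ → ℝ} (ha : ∀ β, 0 < a β)
    (hz : ∀ b : ℝ, ∃ (L : ℕ) (_ : NeZero L) (β : ℝ) (n : ℕ), b ≤ β ∧ 1 ≤ n ∧ 8 * n ≤ L ∧ kappa3 r L β n = 0) :
    ¬ ∃ (Γ₃ : ℝ → ℝ) (β₁ c₃ : ℝ), 0 < c₃ ∧ (∀ s : ℝ, 0 < s → 0 < Γ₃ s) ∧
        ∀ (L : ℕ) [NeZero L] (β : ℝ), β₁ ≤ β →
          ∀ n : ℕ, 1 ≤ n → 8 * n ≤ L → c₃ * Γ₃ ((n : ℝ) * a β) ≤ (n : ℝ) ^ 12 * |kappa3 r L β n| := by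
  rintro ⟨Γ₃, β₁, c₃, hc₃, hΓ₃, hb⟩
  obtain ⟨L, _, β, n, hβ, hn, h8, h0⟩ := hz β₁
  exact global_of_noGuard r ha hc₃ hΓ₃ hb L β n hβ hn h8 h0

end Clauses

section Freedom

variable {G : Type} [Group G] [TopologicalSpace G] [IsTopologicalGroup G] [CompactSpace G]
  [MeasurableSpace G] [BorelSpace G]

/-- **Rescaling up is free for the two-point package**: `a ↦ M·a` (`M ≥ 1`) shrinks the femto boxes and relabels the shape,
`Γ'(s) := Γ(s/M)`; thresholds and constants unchanged. -/
theorem twoPointPackage_const_mul (r : LatticeRep G) {a : ℝ → ℝ} (h : TwoPointPackage r a) {M : ℝ} (hM : 1 ≤ M) :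
    TwoPointPackage r (fun β => M * a β) := by
  obtain ⟨Γ, β₀, ℓ₀, c, C, hℓ₀, hc, ha, ha0, hΓ, hbox⟩ := h
  have hM0 : 0 < M := lt_of_lt_of_le one_pos hM
  refine ⟨fun s => Γ (s / M), β₀, ℓ₀, c, C, hℓ₀, hc, fun β => mul_pos hM0 (ha β), ?_, ?_, ?_⟩
  · simpa using ha0.const_mul M
  · intro s hs hsℓ
    refine hΓ (s / M) (div_pos hs hM0) ?_
    rw [div_le_iff₀ hM0]
    nlinarith
  · intro L _ β hβ hL
    have hL' : (L : ℝ) * a β ≤ ℓ₀ := by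
      have h1 : (L : ℝ) * a β ≤ (L : ℝ) * (M * a β) := by
        have := mul_le_mul_of_nonneg_left (le_mul_of_one_le_left (ha β).le hM) (Nat.cast_nonneg L)
        simpa using this
      exact h1.trans hL
    obtain ⟨hax, hall⟩ := hbox L β hβ hL'
    refine ⟨fun n hn h8 => ?_, fun x y i j i' j' hxy hij hij' => ?_⟩
    · have e : (n : ℝ) * (M * a β) / M = (n : ℝ) * a β := by field_simp
      simp only [e]
      exact hax n hn h8
    · have e : torusDist L x y * (M * a β) / M = torusDist L x y * a β := by field_simp
      simp only [e]
      exact hall x y i j i' j' hxy hij hij'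

/-- **Rescaling up is free for the skewness package** as well (`Γ₃'(s) := Γ₃(s/M)`, same `β₁, ℓ₁, c₃`). -/
theorem skewnessPackage_const_mul (r : LatticeRep G) {a : ℝ → ℝ} (ha : ∀ β, 0 < a β) (h : SkewnessPackage r a) {M : ℝ}
    (hM : 1 ≤ M) : SkewnessPackage r (fun β => M * a β) := by
  obtain ⟨Γ₃, β₁, ℓ₁, c₃, hℓ₁, hc₃, hΓ₃, hb⟩ := h
  have hM0 : 0 < M := lt_of_lt_of_le one_pos hM
  refine ⟨fun s => Γ₃ (s / M), β₁, ℓ₁, c₃, hℓ₁, hc₃, fun s hs hsℓ => hΓ₃ (s / M) (div_pos hs hM0) ?_, ?_⟩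
  · rw [div_le_iff₀ hM0]
    nlinarith
  · intro L _ β hβ hL n hn h8
    have hL' : (L : ℝ) * a β ≤ ℓ₁ := by
      have h1 : (L : ℝ) * a β ≤ (L : ℝ) * (M * a β) := by
        have := mul_le_mul_of_nonneg_left (le_mul_of_one_le_left (ha β).le hM) (Nat.cast_nonneg L)
        simpa using this
      exact h1.trans hL
    have e : (n : ℝ) * (M * a β) / M = (n : ℝ) * a β := by field_simp
    simp only [e]
    exact hb L β hβ hL' n hn h8

/-- **The rebundling realised**: if `a` answers the crux at `(G, r)`, so does `M·a` for every `M ≥ 1` (deeper-femto windows). -/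
theorem answer_const_mul (r : LatticeRep G) {a : ℝ → ℝ} (h : Continuous a ∧ TwoPointPackage r a ∧ SkewnessPackage r a)
    {M : ℝ} (hM : 1 ≤ M) :
    Continuous (fun β => M * a β) ∧ TwoPointPackage r (fun β => M * a β) ∧ SkewnessPackage r (fun β => M * a β) := by
  obtain ⟨hc, hP, hS⟩ := h
  obtain ⟨Γ, β₀, ℓ₀, c, C, -, -, ha, -, -⟩ := id hP
  exact ⟨continuous_const.mul hc, twoPointPackage_const_mul r hP hM, skewnessPackage_const_mul r ha hS hM⟩

/-- **…and constants are ALL the freedom there is**: any two CONTINUOUS maps carrying two-point packages for the same `(G, r)` are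
equivalent up to a constant, eventually (the landed ruler rigidity of line `one-ruler`, read in the `TwoPointPackage` vocabulary).  So
the map named by the conclusion is `≍` the hypothesis' map: the prover may deepen the windows (`answer_const_mul`), never move them to
another scale. -/
theorem continuous_package_maps_comparable (r : LatticeRep G) {a₁ a₂ : ℝ → ℝ} (h₁ : TwoPointPackage r a₁)
    (h₂ : TwoPointPackage r a₂) (hc₁ : Continuous a₁) (hc₂ : Continuous a₂) :
    ∃ K β₃ : ℝ, 0 < K ∧ ∀ β : ℝ, β₃ ≤ β → a₂ β ≤ K * a₁ β ∧ a₁ β ≤ K * a₂ β := by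
  obtain ⟨Γ₁, β₀, ℓ₀, c, C, h₁'⟩ := h₁
  obtain ⟨Γ₂, β₀', ℓ₀', c', C', h₂'⟩ := h₂
  exact rulerRigidity_continuous G r a₁ a₂ Γ₁ Γ₂ β₀ ℓ₀ c C β₀' ℓ₀' c' C' h₁' h₂' hc₁ hc₂

end Freedom

section FixedTorus

variable {G : Type} [Group G] [TopologicalSpace G] [IsTopologicalGroup G] [CompactSpace G]
  [MeasurableSpace G] [BorelSpace G]

/-- **Dichotomy on each fixed torus** (landed `kappa3_zero_set_dichotomy`, real-analyticity in `β`): either `κ₃(L, ·, n) ≡ 0` on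
`ℝ`, or its zeros are isolated.  Hence "frequently zero as `β → ∞`" (kill criterion I) means: identically zero, or isolated zeros
ACCUMULATING at `+∞` — a genuine infinite sign pattern, not an accident of finitely many crossings. -/
theorem frequently_zero_cases (r : LatticeRep G) (L : ℕ) [NeZero L] (n : ℕ)
    (hfreq : ∃ᶠ β in atTop, kappa3 r L β n = 0) :
    (∀ β : ℝ, kappa3 r L β n = 0) ∨
      ((∀ β₀ : ℝ, ∀ᶠ β in 𝓝[≠] β₀, kappa3 r L β n ≠ 0) ∧
        ∀ b : ℝ, ∃ β : ℝ, b ≤ β ∧ kappa3 r L β n = 0) := by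
  rcases kappa3_zero_set_dichotomy r L n with h | h
  · exact Or.inl h
  · refine Or.inr ⟨h, fun b => ?_⟩
    obtain ⟨β, hβ, hb⟩ := (hfreq.and_eventually (eventually_ge_atTop b)).exists
    exact ⟨β, hb, hβ⟩

end FixedTorus

/-- **Kill criterion I, identically-zero form**: a continuous package witness for `(G, r)` plus ONE torus `L ≥ 8n` on which the
cumulant vanishes IDENTICALLY in `β` refutes the crux (whatever continuous map the crux answers with, its windows contain a neighbourhood of
`+∞` on that torus, `eventually_kappa3_ne_zero`).  For SU(2) fundamental at `n = 1` the strong-coupling expansion gives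
`κ₃(P,P,P) = +β⁹/256 + O(β¹⁰) ≢ 0` — sibling Disproof finding 3 — so this door is shut wherever a leading coefficient is known. -/
theorem not_cruxC_of_identically_zero_torus
    (h : ∃ (G : Type) (_ : Group G) (_ : TopologicalSpace G) (_ : IsTopologicalGroup G)
      (_ : CompactSpace G) (_ : IsCompactSimpleLieGroup G),
      letI : MeasurableSpace G := borel G
      haveI : BorelSpace G := ⟨rfl⟩
      ∃ (r : LatticeRep G) (a₀ : ℝ → ℝ), Continuous a₀ ∧ TwoPointPackage r a₀ ∧
        ∃ (L : ℕ) (_ : NeZero L) (n : ℕ), 1 ≤ n ∧ 8 * n ≤ L ∧ ∀ β : ℝ, kappa3 r L β n = 0) :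
    ¬ FemtoCurvatureSkewnessC := by
  intro hcrux
  obtain ⟨G, _, _, _, _, hG, r, a₀, ha₀, h₀, L, _, n, hn, h8, hz⟩ := h
  letI : MeasurableSpace G := borel G
  haveI : BorelSpace G := ⟨rfl⟩
  obtain ⟨a, -, hP, hS⟩ := hcrux G hG r ⟨a₀, ha₀, h₀⟩
  have hP' : TwoPointPackage r a := hP
  have hS' : SkewnessPackage r a := hS
  obtain ⟨Γ, β₀, ℓ₀, c, C, -, -, ha, hat, -⟩ := hP'
  obtain ⟨β, hβ⟩ := (eventually_kappa3_ne_zero r ha hat hS' L n hn h8).exists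
  exact hβ (hz β)

end Summit.QuantumFields.YangMills.Theorems.FemtoCurvatureSkewnessC.Negative
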